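import Mathlib
import Literature.Computability.AlgebraicComplexity.DivisionSLP
import HarnessLib

/-!
# `DetSolveMassThree` (route `LinearSolveSplit`, stmt-MatrixMultiplication-26151) — file 1/2: the generic matrices

§1 two cost lemmas for straight-line programs with division (`derivable_prod`, `derivable_det`); §2 the generic
matrices `X` over `ℂ(X) = FractionRing (MvPolynomial (Fin n × Fin m) ℂ)`, leading blocks `X_{<k}`, Schur pivots
`d_k`, leading minors `D_k` (nonzero: `Matrix.det_mvPolynomialX_ne_zero` transported along the injective sub-block
renaming), the Schur step `D_{k+1} = D_k · d_k` and the telescoping identity; §3 the queries — the generic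
sub-systems `[X_{<k} | c_k]` embedded in `ℂ(X)` along `IsFractionRing.liftAlgHom ∘ MvPolynomial.rename`.

Landing note: the lens-3 kernel `DetSolveMassThree.lean` (decomp-mm gen 4; sha256 75ad05e5…edaf, 490 lines, rc 0 ·
0 sorry · std axioms, critic-endorsed 2026-08-30T04:50:40Z) is landed as two files for the gate rule «Theorems files with
proofs ≤ 400 lines» — `LinearSolveSplitDetSolveMassThreeGeneric` (§§1–3: SLP cost lemmas, the generic matrices and
their leading blocks / Schur telescoping, the embedded generic query systems; imports no route file) and
`LinearSolveSplitDetSolveMassThree` (§§4–6: the rounds, step counts, and the closer `detSolveMassThree_holds`);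
statements and proofs unchanged (20 helper docstrings added), one namespace throughout.
Overview and references: module docstring of `Theorems/LinearSolveSplitDetSolveMassThree.lean` (file 2/2).
-/

set_option linter.dupNamespace false -- `MatrixMultiplication.MatrixMultiplication` (summit = problem, D-0017)

noncomputable section

open scoped BigOperators
open Literature.Computability.AlgebraicComplexity (Derivable DivStep DivSeq)

namespace Summit.MatrixMultiplication.MatrixMultiplication.Theorems.LinearSolveSplitDetSolveMassThree

/-! ## 1. Two cost lemmas for straight-line programs: products and Leibniz determinants -/

section Costs

variable {K : Type*} [Field K] [Algebra ℂ K]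

/-- A product of finitely many available elements costs at most the number of factors. -/
theorem derivable_prod {ι : Type*} (s : Finset ι) {A : Set K} {x : ι → K}
    (hx : ∀ i ∈ s, x i ∈ A ∪ Set.range (algebraMap ℂ K)) :
    Derivable ℂ s.card A {∏ i ∈ s, x i} := by
  classical
  induction s using Finset.induction_on with
  | empty =>
    refine Derivable.of_subset ?_ _
    intro v hv
    simp only [Finset.prod_empty, Set.mem_singleton_iff] at hv
    exact Or.inr ⟨1, by simp [hv]⟩
  | insert a s ha ih =>
    rw [Finset.card_insert_of_notMem ha, Finset.prod_insert ha]
    have h1 := ih fun i hi => hx i (Finset.mem_insert_of_mem hi)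
    have h2 : Derivable ℂ 1 (A ∪ {∏ i ∈ s, x i}) {x a * ∏ i ∈ s, x i} := by
      refine Derivable.mul (k := ℂ) ?_ (Or.inl (Or.inr rfl))
      rcases hx a (Finset.mem_insert_self a s) with h | h
      · exact Or.inl (Or.inl h)
      · exact Or.inr h
    exact h1.trans h2

/-- Leibniz: the determinant of an `m × m` matrix with available entries costs at most
`m!·m + m!` steps — a bound depending on `m` only. -/
theorem derivable_det {m : ℕ} {A : Set K} (M : Matrix (Fin m) (Fin m) K)
    (hM : ∀ i j, M i j ∈ A ∪ Set.range (algebraMap ℂ K)) :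
    Derivable ℂ (m.factorial * m + m.factorial) A {M.det} := by
  classical
  have hcard : (Finset.univ : Finset (Equiv.Perm (Fin m))).card = m.factorial := by
    rw [Finset.card_univ, Fintype.card_perm, Fintype.card_fin]
  have hP : Derivable ℂ (m.factorial * m) A
      (⋃ σ ∈ (Finset.univ : Finset (Equiv.Perm (Fin m))), {∏ i, M (σ i) i}) := by
    have h := Derivable.biUnion (k := ℂ) (Finset.univ : Finset (Equiv.Perm (Fin m)))
      (c := fun _ => m) (A := A) (B := fun σ => {∏ i, M (σ i) i})
      (fun σ _ => by
        have h := derivable_prod (K := K) (Finset.univ : Finset (Fin m)) (A := A)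
          (x := fun i => M (σ i) i) (fun i _ => hM _ _)
        rw [Finset.card_univ, Fintype.card_fin] at h
        exact h)
    rw [Finset.sum_const, smul_eq_mul, hcard] at h
    exact h
  have hS : Derivable ℂ m.factorial
      (A ∪ ⋃ σ ∈ (Finset.univ : Finset (Equiv.Perm (Fin m))), {∏ i, M (σ i) i})
      {∑ σ ∈ (Finset.univ : Finset (Equiv.Perm (Fin m))),
        (((Equiv.Perm.sign σ : ℤˣ) : ℤ) : ℂ) • ∏ i, M (σ i) i} := by
    have h := Derivable.sum (k := ℂ) (Finset.univ : Finset (Equiv.Perm (Fin m)))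
      (fun σ => (((Equiv.Perm.sign σ : ℤˣ) : ℤ) : ℂ))
      (A := A ∪ ⋃ σ ∈ (Finset.univ : Finset (Equiv.Perm (Fin m))), {∏ i, M (σ i) i})
      (x := fun σ => ∏ i, M (σ i) i)
      (fun σ hσ => Or.inl (Or.inr (Set.mem_iUnion₂.mpr ⟨σ, hσ, rfl⟩)))
    rw [hcard] at h
    exact h
  have hdet : M.det = ∑ σ ∈ (Finset.univ : Finset (Equiv.Perm (Fin m))),
      (((Equiv.Perm.sign σ : ℤˣ) : ℤ) : ℂ) • ∏ i, M (σ i) i := by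
    rw [Matrix.det_apply']
    refine Finset.sum_congr rfl fun σ _ => ?_
    rw [Algebra.smul_def, map_intCast]
  rw [hdet]
  exact hP.trans hS

end Costs

/-- Ring maps between fields commute with matrix inversion (invertible and junk case alike). -/
theorem matrix_map_inv {K L : Type*} [Field K] [Field L] (f : K →+* L) {m : Type*} [Fintype m]
    [DecidableEq m] (M : Matrix m m K) : (M⁻¹).map f = (M.map f)⁻¹ := by
  by_cases h : IsUnit M.det
  · have h1 : M⁻¹.map f * M.map f = 1 := by
      rw [← Matrix.map_mul, Matrix.nonsing_inv_mul M h, Matrix.map_one _ (map_zero f) (map_one f)]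
    exact (Matrix.inv_eq_left_inv h1).symm
  · have h' : ¬ IsUnit (M.map f).det := by
      intro hu
      apply h
      rw [isUnit_iff_ne_zero] at hu ⊢
      intro h0
      apply hu
      have : (M.map f).det = f M.det := (RingHom.map_det f M).symm
      rw [this, h0, map_zero]
    rw [Matrix.nonsing_inv_apply_not_isUnit _ h, Matrix.nonsing_inv_apply_not_isUnit _ h']
    exact Matrix.map_zero f (map_zero f)

/-! ## 2. The generic matrices -/

/-- `ℂ(Z)`, `Z` the generic `n × m` matrix. -/
abbrev GF (n m : ℕ) : Type := FractionRing (MvPolynomial (Fin n × Fin m) ℂ)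

/-- The entry `z_p` of `Z` in `ℂ(Z)`. -/
def gE (n m : ℕ) (p : Fin n × Fin m) : GF n m :=
  algebraMap (MvPolynomial (Fin n × Fin m) ℂ) (GF n m) (MvPolynomial.X p)

/-- The matrix `X'` of the generic system `[X' | b']` of size `k`. -/
def sysMatrix (k : ℕ) : Matrix (Fin k) (Fin k) (GF k (k + 1)) :=
  Matrix.of fun i j => gE k (k + 1) (i, Fin.castSucc j)

/-- Its right-hand side `b'`. -/
def sysRhs (k : ℕ) : Fin k → GF k (k + 1) := fun i => gE k (k + 1) (i, Fin.last k)

/-- Its solution `X'⁻¹ b'`. -/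
def sysSolution (k : ℕ) : Fin k → GF k (k + 1) := Matrix.mulVec (sysMatrix k)⁻¹ (sysRhs k)

/-- The generic `n × n` determinant in `ℂ(X)`. -/
def genDet (n : ℕ) : GF n n :=
  algebraMap (MvPolynomial (Fin n × Fin n) ℂ) (GF n n)
    (Matrix.det (Matrix.of fun i j : Fin n => MvPolynomial.X (i, j)))

/-- The entries of the generic square matrix `X`, indexed by naturals (junk `0` outside). -/
def xe (n : ℕ) (i j : ℕ) : GF n n :=
  if h : i < n ∧ j < n then gE n n (⟨i, h.1⟩, ⟨j, h.2⟩) else 0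

/-- `xe n i j` is the generic entry `x_{ij}` for in-range indices. -/
theorem xe_eq {n i j : ℕ} (hi : i < n) (hj : j < n) :
    xe n i j = gE n n (⟨i, hi⟩, ⟨j, hj⟩) := by
  simp only [xe, dif_pos (And.intro hi hj)]

/-- In-range entries `xe n i j` are variables (in the range of `gE n n`). -/
theorem xe_mem {n i j : ℕ} (hi : i < n) (hj : j < n) : xe n i j ∈ Set.range (gE n n) := by
  rw [xe_eq hi hj]
  exact ⟨_, rfl⟩

/-- The leading `k × k` block `X_{<k}`. -/
def Xk (n k : ℕ) : Matrix (Fin k) (Fin k) (GF n n) := Matrix.of fun i j => xe n i j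

/-- Column `k` of `X`, rows `< k`. -/
def ck (n k : ℕ) : Fin k → GF n n := fun i => xe n i k

/-- `u_k = X_{<k}⁻¹ c_k` (the answer to query `k`). -/
def uk (n k : ℕ) : Fin k → GF n n := Matrix.mulVec (Xk n k)⁻¹ (ck n k)

/-- The Schur pivot `d_k = x_{kk} − Σ_{j<k} x_{kj} u_{k,j}`. -/
def dk (n k : ℕ) : GF n n := xe n k k - ∑ j : Fin k, xe n k j * uk n k j

/-- The leading principal minor `det X_{<k}`. -/
def Dk (n k : ℕ) : GF n n := (Xk n k).det

/-! ### Invertibility of the generic leading blocks -/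

/-- The square sub-block renaming `ℂ[Z_{k×k}] →ₐ ℂ(X)`. -/
def sqHom (n k : ℕ) (hk : k ≤ n) : MvPolynomial (Fin k × Fin k) ℂ →ₐ[ℂ] GF n n :=
  (IsScalarTower.toAlgHom ℂ (MvPolynomial (Fin n × Fin n) ℂ) (GF n n)).comp
    (MvPolynomial.rename fun p : Fin k × Fin k => (Fin.castLE hk p.1, Fin.castLE hk p.2))

/-- The sub-block renaming `ℂ[Z_{k×k}] →ₐ ℂ(X)` is injective. -/
theorem sqHom_injective {n k : ℕ} (hk : k ≤ n) : Function.Injective (sqHom n k hk) := by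
  have hinj : Function.Injective fun p : Fin k × Fin k => (Fin.castLE hk p.1, Fin.castLE hk p.2) := by
    intro p q h
    simp only [Prod.mk.injEq] at h
    exact Prod.ext (Fin.castLE_injective _ h.1) (Fin.castLE_injective _ h.2)
  exact (IsFractionRing.injective (MvPolynomial (Fin n × Fin n) ℂ) (GF n n)).comp
    (MvPolynomial.rename_injective _ hinj)

/-- `sqHom` sends the variable `Z_p` to the entry `x_p` of the leading block. -/
theorem sqHom_X {n k : ℕ} (hk : k ≤ n) (p : Fin k × Fin k) :
    sqHom n k hk (MvPolynomial.X p) = gE n n (Fin.castLE hk p.1, Fin.castLE hk p.2) := by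
  simp only [sqHom, AlgHom.comp_apply, MvPolynomial.rename_X, IsScalarTower.toAlgHom_apply]
  rfl

/-- The leading block `X_{<k}` is the image of the generic matrix under `sqHom`. -/
theorem Xk_eq_map {n k : ℕ} (hk : k ≤ n) :
    Xk n k = (Matrix.mvPolynomialX (Fin k) (Fin k) ℂ).map (sqHom n k hk) := by
  ext i j
  rw [Matrix.map_apply, Matrix.mvPolynomialX_apply, sqHom_X, Xk, Matrix.of_apply,
    xe_eq (lt_of_lt_of_le i.2 hk) (lt_of_lt_of_le j.2 hk)]
  rfl

/-- The leading minor `D_k = det X_{<k}` is nonzero (`k ≤ n`). -/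
theorem Dk_ne_zero {n k : ℕ} (hk : k ≤ n) : Dk n k ≠ 0 := by
  rw [Dk, Xk_eq_map hk]
  have h := RingHom.map_det (sqHom n k hk : MvPolynomial (Fin k × Fin k) ℂ →+* GF n n)
    (Matrix.mvPolynomialX (Fin k) (Fin k) ℂ)
  rw [RingHom.mapMatrix_apply] at h
  simp only [RingHom.coe_coe] at h
  rw [← h]
  exact (map_ne_zero_iff _ (sqHom_injective hk)).mpr (Matrix.det_mvPolynomialX_ne_zero (Fin k) ℂ)

/-- The leading block `X_{<k}` has invertible determinant (`k ≤ n`). -/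
theorem isUnit_Dk {n k : ℕ} (hk : k ≤ n) : IsUnit (Xk n k).det :=
  isUnit_iff_ne_zero.mpr (Dk_ne_zero hk)

/-! ### The Schur step and the telescoping identity -/

/-- `det X_{≤k} = det X_{<k} · d_k`. -/
theorem Dk_succ {n k : ℕ} (hk : k + 1 ≤ n) : Dk n (k + 1) = Dk n k * dk n k := by
  letI : Invertible (Xk n k) := Matrix.invertibleOfIsUnitDet _ (isUnit_Dk (Nat.le_of_succ_le hk))
  have hblock : (Xk n (k + 1)).submatrix (finSumFinEquiv (m := k) (n := 1))
      (finSumFinEquiv (m := k) (n := 1)) =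
      Matrix.fromBlocks (Xk n k) (Matrix.of fun (i : Fin k) (_ : Fin 1) => xe n i k)
        (Matrix.of fun (_ : Fin 1) (j : Fin k) => xe n k j) (Matrix.of fun (_ _ : Fin 1) => xe n k k) := by
    ext (i | i) (j | j) <;>
      simp [Xk, Matrix.fromBlocks, finSumFinEquiv_apply_left, finSumFinEquiv_apply_right]
  unfold Dk
  rw [← Matrix.det_submatrix_equiv_self (finSumFinEquiv (m := k) (n := 1)) (Xk n (k + 1)), hblock,
    Matrix.det_fromBlocks₁₁, Matrix.det_fin_one, Matrix.invOf_eq_nonsing_inv, Matrix.mul_assoc]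
  congr 1

/-- Telescoping: `det X_{<m₀+j} = det X_{<m₀} · ∏_{m₀ ≤ k < m₀+j} d_k`. -/
theorem Dk_telescope {n m₀ : ℕ} (j : ℕ) (hj : m₀ + j ≤ n) :
    Dk n (m₀ + j) = Dk n m₀ * ∏ k ∈ Finset.Ico m₀ (m₀ + j), dk n k := by
  induction j with
  | zero => simp
  | succ j ih =>
    rw [← Nat.add_assoc, Finset.prod_Ico_succ_top (Nat.le_add_right m₀ j), ← mul_assoc,
      ← ih (Nat.le_of_succ_le hj), Dk_succ (k := m₀ + j) hj]

/-- The generic determinant is the top leading minor `D_n`. -/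
theorem genDet_eq_Dk (n : ℕ) : genDet n = Dk n n := by
  unfold genDet Dk
  rw [RingHom.map_det, RingHom.mapMatrix_apply]
  congr 1
  ext i j
  rw [Matrix.map_apply, Matrix.of_apply, Xk, Matrix.of_apply, xe_eq i.2 j.2]
  rfl

/-- `det X = det X_{<m₀} · ∏_{k=m₀}^{n-1} d_k`. -/
theorem genDet_eq_prod {n m₀ : ℕ} (h : m₀ ≤ n) :
    genDet n = Dk n m₀ * ∏ k ∈ Finset.Ico m₀ n, dk n k := by
  have key := Dk_telescope (n := n) (m₀ := m₀) (n - m₀) (by omega)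
  rw [Nat.add_sub_cancel' h] at key
  rw [genDet_eq_Dk, key]

/-! ## 3. The queries: the generic sub-systems `[X_{<k} | c_k]` embedded in `ℂ(X)` -/

/-- The sub-block renaming `Z_{k×(k+1)} ↪ X`: rows `< k`, columns `≤ k`. -/
def rho (n k : ℕ) (hk : k + 1 ≤ n) (p : Fin k × Fin (k + 1)) : Fin n × Fin n :=
  (Fin.castLE (Nat.le_of_succ_le hk) p.1, Fin.castLE hk p.2)

/-- The index renaming `rho` of the `k`-th query is injective. -/
theorem rho_injective {n k : ℕ} (hk : k + 1 ≤ n) : Function.Injective (rho n k hk) := by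
  intro p q h
  simp only [rho, Prod.mk.injEq] at h
  exact Prod.ext (Fin.castLE_injective _ h.1) (Fin.castLE_injective _ h.2)

/-- The renaming as an injective `ℂ`-algebra map `ℂ[Z_{k×(k+1)}] →ₐ ℂ(X)`. -/
def polyHom (n k : ℕ) (hk : k + 1 ≤ n) : MvPolynomial (Fin k × Fin (k + 1)) ℂ →ₐ[ℂ] GF n n :=
  (IsScalarTower.toAlgHom ℂ (MvPolynomial (Fin n × Fin n) ℂ) (GF n n)).comp
    (MvPolynomial.rename (rho n k hk))

/-- The polynomial embedding of the `k`-th query system is injective. -/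
theorem polyHom_injective {n k : ℕ} (hk : k + 1 ≤ n) : Function.Injective (polyHom n k hk) :=
  (IsFractionRing.injective (MvPolynomial (Fin n × Fin n) ℂ) (GF n n)).comp
    (MvPolynomial.rename_injective _ (rho_injective hk))

/-- The query embedding: the `ℂ`-algebra map of FIELDS `ℂ(Z_{k×(k+1)}) →ₐ[ℂ] ℂ(X)` sending
`[X' | b']` to `[X_{<k} | c_k]`. -/
def emb (n k : ℕ) (hk : k + 1 ≤ n) : GF k (k + 1) →ₐ[ℂ] GF n n :=
  IsFractionRing.liftAlgHom (polyHom_injective hk)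

/-- `emb` on polynomials is the renaming `rho` (compatibility with `algebraMap`). -/
theorem emb_algebraMap {n k : ℕ} (hk : k + 1 ≤ n) (P : MvPolynomial (Fin k × Fin (k + 1)) ℂ) :
    emb n k hk (algebraMap (MvPolynomial (Fin k × Fin (k + 1)) ℂ) (GF k (k + 1)) P) =
      algebraMap (MvPolynomial (Fin n × Fin n) ℂ) (GF n n) (MvPolynomial.rename (rho n k hk) P) := by
  rw [emb, IsFractionRing.liftAlgHom_apply, IsFractionRing.lift_algebraMap]
  rfl

/-- `emb` sends the query variable `Z_p` to the entry `x_{rho p}`. -/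
theorem emb_gE {n k : ℕ} (hk : k + 1 ≤ n) (p : Fin k × Fin (k + 1)) :
    emb n k hk (gE k (k + 1) p) = gE n n (rho n k hk p) := by
  show emb n k hk (algebraMap _ _ (MvPolynomial.X p)) = algebraMap _ _ (MvPolynomial.X (rho n k hk p))
  rw [emb_algebraMap, MvPolynomial.rename_X]

/-- The embedded query matrix is the leading block `X_{<k}`. -/
theorem sysMatrix_map {n k : ℕ} (hk : k + 1 ≤ n) : (sysMatrix k).map (emb n k hk) = Xk n k := by
  ext i j
  rw [Matrix.map_apply, sysMatrix, Matrix.of_apply, emb_gE, Xk, Matrix.of_apply,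
    xe_eq (by have := i.2; omega) (by have := j.2; omega)]
  rfl

/-- The embedded query right-hand side is the column `c_k = (x_{ik})_{i<k}`. -/
theorem sysRhs_map {n k : ℕ} (hk : k + 1 ≤ n) : (emb n k hk) ∘ sysRhs k = ck n k := by
  funext i
  rw [Function.comp_apply, sysRhs, emb_gE, ck, xe_eq (by have := i.2; omega) (by omega)]
  rfl

/-- The oracle's answer to query `k` is `u_k = X_{<k}⁻¹ c_k`. -/
theorem emb_sysSolution {n k : ℕ} (hk : k + 1 ≤ n) (j : Fin k) :
    emb n k hk (sysSolution k j) = uk n k j := by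
  have h := RingHom.map_mulVec (emb n k hk : GF k (k + 1) →+* GF n n) (sysMatrix k)⁻¹ (sysRhs k) j
  rw [matrix_map_inv] at h
  simp only [RingHom.coe_coe] at h
  rw [sysSolution, h, sysMatrix_map, sysRhs_map]
  rfl

end Summit.MatrixMultiplication.MatrixMultiplication.Theorems.LinearSolveSplitDetSolveMassThree

end
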